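import Summits.RiemannHypothesis.RiemannHypothesis.Theorems.UniversalFactorMediumLowWindowA

/-!
# RiemannHypothesis / UniversalFactor — low window C of `MediumKernelNoGo` (certified computation)

Route `RiemannHypothesis/UniversalFactor`, crux `MediumKernelNoGo` (stmt-RiemannHypothesis-2577), line
`one-sided-average-sign-test`.  ONE `native_decide` evaluation of the certified checker
(`UniversalFactorMediumDefs/BoxDefs/LowDefs.lean`, soundness `UniversalFactorMediumCover.lean`):
at the point `x = 223.2` (hump: `H_0(x) > 0`), with `32 + 32` Gauss–Legendre y-cells of width 4, the
backward and forward one-sided Laplace(`a`) averages of `H_0` are negative for every `a` of each of the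
9 boxes covering `[0.7, 1.521472]` — interval weights `[e^{−a₂y}, e^{−a₁y}]` carry the continuum of `a`.

-/

set_option linter.dupNamespace false

noncomputable section

namespace Summit.RiemannHypothesis.RiemannHypothesis.Theorems

open MeasureTheory Set
open Literature.NumberTheory.LFunctions
open Literature.Analysis.ValidatedNumerics Literature.Analysis.ValidatedNumerics.NumericsMP

/-- **The certified computation of window C** (`native_decide`; the only computational step). [folklore] -/
theorem UniversalFactor.osaWindowC_check :
    UniversalFactor.osaWindowCheck UniversalFactor.osaPtC UniversalFactor.osaAsC = true := by
  native_decide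

/-- **Registered sub-goal `stub_lowWindowC` — low window C**: every `a ∈ [700000·10⁻⁶, 1521472·10⁻⁶]` has a point `x ≥ 0` (namely `x = 223.2`) with
a filled dip or hump of the one-sided Laplace(`a`) averages of `H_0`. [folklore] -/
theorem UniversalFactor.stub_lowWindowC : ∀ a : ℝ, (700000 : ℝ) / 1000000 ≤ a → a ≤ (1521472 : ℝ) / 1000000 →
    ∃ x : ℝ, 0 ≤ x ∧
      (((deBruijnH 0 x).re < 0 ∧
          0 < (∫ y in Ioi (0:ℝ), deBruijnH 0 ((x : ℂ) - y) * (Real.exp (-(a * y)) : ℂ)).re ∧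
          0 < (∫ y in Ioi (0:ℝ), deBruijnH 0 ((x : ℂ) + y) * (Real.exp (-(a * y)) : ℂ)).re) ∨
        (0 < (deBruijnH 0 x).re ∧
          (∫ y in Ioi (0:ℝ), deBruijnH 0 ((x : ℂ) - y) * (Real.exp (-(a * y)) : ℂ)).re < 0 ∧
          (∫ y in Ioi (0:ℝ), deBruijnH 0 ((x : ℂ) + y) * (Real.exp (-(a * y)) : ℂ)).re < 0)) :=
  fun a h1 h2 => UniversalFactor.osaWindowCheck_sound UniversalFactor.osaWindowC_check (by simp [UniversalFactor.osaAsC]) a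
    (by simpa [UniversalFactor.osaAsC, UniversalFactor.osaAD] using h1)
    (by simpa [UniversalFactor.osaAsC, UniversalFactor.osaAD] using h2)

end Summit.RiemannHypothesis.RiemannHypothesis.Theorems
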